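import Summits.QuantumFields.YangMills.Theorems.UnitScaleTiltProp8ChartDefs
import Summits.QuantumFields.YangMills.Theorems.UnitScaleTiltProp8FlatCubeOpsText
import HarnessLib

/-!
# Route `UnitScaleTilt`, crux K1 «MinimiserStabilityRegPr» (stmt-QuantumFields-19200), leaf V2′ `stub_halvingStep` — pillar P3 `ChartPerLevel`,
# TEXT (C-part + H-part): **THE k-UNIFORM CHART OF THE MULTI-LEVEL (0.4)-CONSTRAINT AT BACKGROUND 1** ([Balaban1985Variational] (44)–(48) per level,
# in the letters of the F4 pen's `FlatSmallSolution158CubeSeq.chart47_dom`)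

Cell `ym3-torus` ∕ fleet seat `ym-ust-19200-p2` g5 (v8 PEN; OWNER RULING g20-№13 AMENDMENT A «P3 `stub_chartPerLevel` (Sects. C–E per level, K-uniform: Prop 3
chart remainder C (hCq/hCd letters) ∧ Prop 4 nonlinear part W at background 1 … kept SEPARATE inside the text)», g21-№5 §3–§4).  This file TYPES the
FIRST conjunct (the chart remainder `C` and the right inverse `H` of the linearised constraint) as a Prop-valued predicate — NOTHING IS ASSERTED; the
second conjunct (Prop. 4 (98) at background 1, letters `hWq`/`hWd`) is a separate text (it needs the charted functional (157)).

THE PINNED OBJECTS (vet AUDIT-19200-pillars §3/§8 «never bare ∃ C, letters»): the constraint map is `Prop8Chart.chartLog η D` — print's `(1/i)·log` reading of the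
multi-level (0.4) data of `e^{iηA}` on the index set `BondIdx D` ([Balaban1985Variational] (154)–(157)), `η = L^{−(K−n)}`, whose unguarded averages ARE the
family's (0.4)-descent on (6)(ε₀) (`Prop8Chart.coe_emlIterU_unitsField_T3`); `C := chartLog − D(chartLog)(0)` (Prop. 3's nonlinear part of the constraint in
the chart, (44) `C_j`), `Qlin := D(chartLog)(0)` = `η·(Lʲ·Q_j − dΛ_j)` level by level (this lineage's p522364: the TRUE linearised (0.4)-constraint =
print's `LʲηQ_j` minus a coarse pure gauge — junction G3 of the vet, carried HERE by the right inverse `H` of the TRUE `Qlin`, not of `QE`).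

THE TEXT `ChartRemainderAt L R₀ M₀ C₂ R B₀`: for every member `F` (`F.L = L`), heights `n < K`, separations `R′ ≥ R₀`, big blocks `M ≥ M₀`, `M = L^a`, every
nested family `D : Domains (F.P K)` with `D.k = K − n` admissible in the sense (2.1)–(2.2) (`FlatCubeOpsText.Adm22 D R′ M` — the SAME binders as P2's
`FlatOpsAdmPowAt`, so P5 instantiates both at the M-aligned cube sequence), and the level weights `w` of the F4 pen (`FlatCubeOpsText.IsLevWeight`):
(hCd) `chartLog η D` is ℂ-differentiable on the weighted sup-ball `{Y | ∀ b, w 1 b·‖Y b‖ < R}`; (hCq) for `r < R` and `w 1 b·‖Y b‖ ≤ r`: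
`‖(chartLog η D Y − D(chartLog η D)(0) Y)(j, c)‖ ≤ C₂·r²` at EVERY index (un-weighted output, as `chart47_dom`'s `hCq`); (hH) there is a ℂ-LINEAR right
inverse `H` of `D(chartLog η D)(0)` with `chart47_dom`'s letter `(∀ i, ‖X i‖ ≤ t) ⇒ w 1 b·‖H X b‖ ≤ B₀·t`.  Constants `R₀ M₀ C₂ R B₀` BEFORE the member
(print: «C₂, R depend on d and L only»).  Numerical support for k-uniformity of (hCq) at the top level (kit jobs j281159/j281163/j281164, evidence on the
item): the quadratic coefficient of `t ↦ chartLog(tA)` at smooth `A` does not grow with `k` (L = 3, k = 1, 2, 3).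
WHY ADMISSIBILITY: without (2.2)'s one-block separation a `Λ_j` index bond may read fine bonds of a territory `j′ ≪ j`, where the weighted ball allows
deviations `rL^{−j′}` and the un-weighted output letter fails by `L^{j−j′}`; with it `j′ ≥ j − 1` (a constant `L`).
STUB SHAPE OF RECORD (v8; NOT declared here — a parameterless Prop in Theorems/ would be relocated by the gate):
`theorem stub_chartRemainder : ∀ (L : ℕ), 1 < L → ∃ (R₀ M₀ : ℕ) (C₂ R B₀ : ℝ), 0 ≤ C₂ ∧ 0 < R ∧ 0 ≤ B₀ ∧ Prop8Chart.ChartRemainderAt L R₀ M₀ C₂ R B₀`.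
HONEST SCOPE.  A predicate; its truth ([Balaban1985Averaging] Props. 3–4 for the (0.4) averaging, k-uniform in the weighted norms; the right inverse by the
face-field construction of p521175 level by level, or the gauge-corrected `H′` of the vet §3(b)) is pillar P3's content, not proved here.  The normalisation
dictionary for P5: P2's `HSupLetterG` weighs DATA by `L^{j(c)}η` (tree reading, plain means `QE`), the chart letters take un-weighted data in print's reading —
`X_tree(j,c) = (L^jη)⁻¹·X_print(j,c)` (`Prop8Chart.chartLog_eq_smul_chartQ`).  NOT a claim about the mass gap.

References: T. Bałaban, CMP **102** (1985) 277–309 [Balaban1985Variational] ((44)–(48) p.287, (154)–(157) p.302); CMP **98** (1985) 17–51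
[Balaban1985Averaging] (Props. 3–4 pp.36–37); CMP **96** (1984) 223–250 [Balaban1984PropagatorsII] ((2.1)–(2.2) p.224).
-/

noncomputable section

open scoped BigOperators Matrix.Norms.L2Operator

namespace Summit.QuantumFields.YangMills.Theorems.Prop8Chart

open Literature.MathematicalPhysics.QuantumFieldTheory.Balaban1983to89
open B6SectADomainsV1 (Domains)
open B6SectAOperatorsV1 (BondIdx)
open T3ContinuumYM3Torus (T3Family)
open Summit.QuantumFields.YangMills.Theorems.FlatCubeOpsText (Adm22 IsLevWeight)

/-- **PILLAR P3, FIRST CONJUNCT — THE k-UNIFORM CHART OF THE MULTI-LEVEL (0.4)-CONSTRAINT AT BACKGROUND 1** in `chart47_dom`'s letters (see the module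
docstring for every symbol): holomorphy of `chartLog η D` on the weighted sup-ball of radius `R` (hCd), the quadratic remainder bound `C₂r²` at every index
(hCq), and a ℂ-linear right inverse `H` of the linearisation with the weighted sup letter `B₀` (hH) — for every member, heights, admissible nested family
with the binders of P2's `FlatOpsAdmPowAt`, and the F4 pen's level weights.  A predicate; nothing asserted.
[cite: Balaban1985Variational, (44)-(48) p.287, (156)-(157) p.302; Balaban1985Averaging, Prop. 3 p.36] -/
def ChartRemainderAt (L : ℕ) (R₀ M₀ : ℕ) (C₂ R B₀ : ℝ) : Prop :=
  ∀ (F : T3Family), F.L = L → ∀ (n K : ℕ), n < K → ∀ (R' M : ℕ), R₀ ≤ R' → M₀ ≤ M → (∃ a : ℕ, M = L ^ a) →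
    ∀ (D : Domains (F.P K)), D.k = K - n → Adm22 D R' M →
    ∀ (w : ℕ → PBond (F.P K) 0 → ℝ), IsLevWeight F n K D w →
      DifferentiableOn ℂ
          (chartLog (((F.L : ℝ)⁻¹) ^ (K - n)) D :
            (PBond (F.P K) 0 → Matrix (Fin 2) (Fin 2) ℂ) → BondIdx D → Matrix (Fin 2) (Fin 2) ℂ)
          {Y | ∀ b, w 1 b * ‖Y b‖ < R} ∧
      (∀ (Y : PBond (F.P K) 0 → Matrix (Fin 2) (Fin 2) ℂ) (r : ℝ), r < R → (∀ b, w 1 b * ‖Y b‖ ≤ r) →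
          ∀ i : BondIdx D,
            ‖chartLog (((F.L : ℝ)⁻¹) ^ (K - n)) D Y i -
                (fderiv ℂ (chartLog (((F.L : ℝ)⁻¹) ^ (K - n)) D :
                  (PBond (F.P K) 0 → Matrix (Fin 2) (Fin 2) ℂ) → BondIdx D → Matrix (Fin 2) (Fin 2) ℂ) 0) Y i‖ ≤ C₂ * r ^ 2) ∧
      ∃ H : (BondIdx D → Matrix (Fin 2) (Fin 2) ℂ) →ₗ[ℂ] (PBond (F.P K) 0 → Matrix (Fin 2) (Fin 2) ℂ),
        (∀ X : BondIdx D → Matrix (Fin 2) (Fin 2) ℂ,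
            (fderiv ℂ (chartLog (((F.L : ℝ)⁻¹) ^ (K - n)) D :
              (PBond (F.P K) 0 → Matrix (Fin 2) (Fin 2) ℂ) → BondIdx D → Matrix (Fin 2) (Fin 2) ℂ) 0) (H X) = X) ∧
        ∀ (X : BondIdx D → Matrix (Fin 2) (Fin 2) ℂ) (t : ℝ), 0 ≤ t → (∀ i, ‖X i‖ ≤ t) → ∀ b, w 1 b * ‖H X b‖ ≤ B₀ * t

/-- `ChartRemainderAt` is monotone in the thresholds: larger `R₀`, `M₀` (fewer families) and larger `C₂`, `B₀`, smaller `R` (weaker letters) are implied.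
[cite: Balaban1985Variational, (44)-(48) p.287] -/
theorem chartRemainderAt_mono {L R₀ M₀ R₀' M₀' : ℕ} {C₂ R B₀ C₂' R' B₀' : ℝ} (hR₀ : R₀ ≤ R₀') (hM₀ : M₀ ≤ M₀')
    (hC₂ : C₂ ≤ C₂') (hR : R' ≤ R) (hB₀ : B₀ ≤ B₀') (h : ChartRemainderAt L R₀ M₀ C₂ R B₀) :
    ChartRemainderAt L R₀' M₀' C₂' R' B₀' := by
  intro F hF n K hnK Rs M hRs hM hpow D hDk hAdm w hw
  obtain ⟨hCd, hCq, H, hHinv, hH⟩ := h F hF n K hnK Rs M (hR₀.trans hRs) (hM₀.trans hM) hpow D hDk hAdm w hw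
  refine ⟨hCd.mono fun Y hY b => (hY b).trans_le hR, fun Y r hr hY i => ?_, H, hHinv, fun X t ht hX b => ?_⟩
  · have hr0 : 0 ≤ r ^ 2 := sq_nonneg r
    exact (hCq Y r (hr.trans_le hR) hY i).trans (mul_le_mul_of_nonneg_right hC₂ hr0)
  · exact (hH X t ht hX b).trans (mul_le_mul_of_nonneg_right hB₀ ht)

end Summit.QuantumFields.YangMills.Theorems.Prop8Chart

end
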